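import Literature.NumberTheory.Sieve.PolynomialCongruencesLemmas
import HarnessLib

/-!
# Duke–Friedlander–Iwaniec 1995, §5: the Chinese-remainder structure behind Cauchy's inequality

Topic `Literature/NumberTheory/Sieve`.  Third file of the deduction of DFI's Propositions 1–2 from
Proposition 4 (W. Duke, J. B. Friedlander, H. Iwaniec, Ann. of Math. 141 (1995), §5
pp. 432–433).  For the bilinear form `B(M, N) = ∑∑_{(m,n)=1} α_m β_n ρ_h(mn)` the paper "arranges"
`ρ_h(mn) = ∑_{f(δ) ≡ 0 (m)} ∑_{f(ν) ≡ 0 (mn), ν ≡ δ (m)} e(νh/mn)`, applies Cauchy's inequality in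
`(m, δ)`, and is led to the sums
`∑∑_{f(ν_j) ≡ 0 (mn_j), ν₁ ≡ ν₂ (m)} e(ν₁h/mn₁ − ν₂h/mn₂)`, about which it says: for `n₁ = n₂` "we
shall use the trivial bound", and for `n₁ ≠ n₂` primes, "`m, n₁, n₂` are pairwise co-prime so we
can write" the sum as `∑_{f(ν) ≡ 0 (mn₁n₂)} e(ν(n₂ − n₁)h / mn₁n₂)` (p. 433).  This file PROVES
these two facts about the root sets, in Mathlib's `ZMod` language of
`PolynomialCongruencesLemmas.lean` (`polyRootsMod f d ⊆ ZMod d`, `polyRootWeylSumZMod`,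
`ZMod.stdAddChar`, `ZMod.castHom_comp`), for an arbitrary `f ∈ ℤ[X]`:

* `DFI1995.crt_fibre_sum_eq` — for `m ⊥ n₂`, `n₁ ⊥ n₂`:
  `∑_{ν₁ ∈ R(mn₁)} ∑_{ν₂ ∈ R(mn₂), ν₂ ≡ ν₁ (m)} ψ_{mn₁}(hν₁) ψ_{mn₂}(−hν₂) = W_f(h(n₂ − n₁); mn₁n₂)`
  (the bijection `ν ↦ (ν mod mn₁, ν mod mn₂)` from `R(mn₁n₂)` onto the congruent pairs, and
  `e(hν/mn₁ − hν/mn₂) = e(h(n₂−n₁)ν/mn₁n₂)`);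
* `DFI1995.card_fibre_le` / `DFI1995.norm_diag_fibre_sum_le` — for `m ⊥ n` each fibre
  `{ν ∈ R(mn) : ν ≡ δ (m)}` has at most `ρ(n)` elements, whence the diagonal sum is at most
  `ρ(mn) ρ(n)` in absolute value ("the trivial bound `B_{nn}(M) ≪ M`");
* `DFI1995.polyRootWeylSumZMod_eq_sum_fibre` — the arrangement
  `W_f(a; mn) = ∑_{δ ∈ R(m)} ∑_{ν ∈ R(mn), ν ≡ δ (m)} ψ_{mn}(aν)`.

## References

* W. Duke, J. B. Friedlander, H. Iwaniec, *Equidistribution of roots of a quadratic congruence to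
  prime moduli*, Ann. of Math. (2) 141 (1995), 423–441, §5 pp. 432–433.
  [cite: DukeFriedlanderIwaniec1995, §5 pp. 432–433]
-/

noncomputable section

namespace Literature.NumberTheory.Sieve

open scoped BigOperators Polynomial
open Finset Polynomial

namespace DFI1995

variable (f : ℤ[X])

/-! ### Casts between the `ZMod`'s -/

/-- Roots descend along divisibility of the modulus. [folklore] -/
theorem castHom_mem_polyRootsMod {D N : ℕ} [NeZero D] [NeZero N] (hDN : D ∣ N) {x : ZMod N}
    (hx : x ∈ polyRootsMod f N) : ZMod.castHom hDN (ZMod D) x ∈ polyRootsMod f D := by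
  obtain ⟨v, rfl⟩ : ∃ v : ℤ, (v : ZMod N) = x := ⟨(x.val : ℤ), by simp⟩
  rw [map_intCast, intCast_mem_polyRootsMod]
  rw [intCast_mem_polyRootsMod] at hx
  exact (Int.natCast_dvd_natCast.2 hDN).trans hx

/-- **Compatibility of the standard characters**: for `D ∣ N`,
`ψ_N(t (N/D) z) = ψ_D(t z̄)` (`e(t (N/D) z / N) = e(t z / D)`). [folklore] -/
theorem stdAddChar_mul_div {D N : ℕ} [NeZero D] [NeZero N] (hDN : D ∣ N) (t : ℤ) (z : ZMod N) :
    ZMod.stdAddChar (((t * (N / D : ℕ) : ℤ) : ZMod N) * z) =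
      ZMod.stdAddChar ((t : ZMod D) * ZMod.castHom hDN (ZMod D) z) := by
  obtain ⟨v, rfl⟩ : ∃ v : ℤ, (v : ZMod N) = z := ⟨(z.val : ℤ), by simp⟩
  obtain ⟨k, hk⟩ := hDN
  have hD0 : 0 < D := Nat.pos_of_ne_zero (NeZero.ne D)
  have hk' : N / D = k := by rw [hk, Nat.mul_div_cancel_left _ hD0]
  simp only [map_intCast]
  rw [← Int.cast_mul, ← Int.cast_mul, ZMod.stdAddChar_coe, ZMod.stdAddChar_coe, hk']
  congr 1
  have hDc : (D : ℂ) ≠ 0 := by exact_mod_cast hD0.ne'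
  have hkc : (k : ℂ) ≠ 0 := by
    have : k ≠ 0 := by rintro rfl; rw [mul_zero] at hk; exact NeZero.ne N hk
    exact_mod_cast this
  rw [hk]
  push_cast
  field_simp

/-- `‖ψ_N(a)‖ = 1`. [folklore] -/
theorem norm_stdAddChar {N : ℕ} [NeZero N] (a : ZMod N) : ‖ZMod.stdAddChar a‖ = 1 := by
  rw [ZMod.stdAddChar_apply]
  exact Circle.norm_coe _

/-! ### Fibres of `R(mn) → R(m)` -/

/-- **The arrangement** `W_f(a; mn) = ∑_{δ ∈ R(m)} ∑_{ν ∈ R(mn), ν ≡ δ (m)} ψ_{mn}(a ν)`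
("First we arrange as follows: `B(M,N) = ∑_m α_m ∑_{f(δ)≡0 (m)} ∑_{(n,m)=1} β_n ∑_{f(ν)≡0 (mn), ν≡δ (m)} e(νh/mn)`",
p. 432). [cite: DukeFriedlanderIwaniec1995, §5 p. 432] -/
theorem polyRootWeylSumZMod_eq_sum_fibre (m n : ℕ) [NeZero m] [NeZero (m * n)] (a : ZMod (m * n)) :
    polyRootWeylSumZMod f (m * n) a =
      ∑ δ ∈ polyRootsMod f m, ∑ ν ∈ (polyRootsMod f (m * n)).filter
        (fun ν => ZMod.castHom (dvd_mul_right m n) (ZMod m) ν = δ), ZMod.stdAddChar (a * ν) := by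
  rw [polyRootWeylSumZMod_def]
  exact (Finset.sum_fiberwise_of_maps_to
    (fun ν hν => castHom_mem_polyRootsMod f (dvd_mul_right m n) hν) _).symm

/-- **Fibres are small**: for `(m, n) = 1` and `δ ∈ ℤ/m`, the roots `ν` of `f` modulo `mn` with
`ν ≡ δ (mod m)` number at most `ρ_f(n)` (the map `ν ↦ ν mod n` is injective on the fibre, by the
Chinese remainder theorem). [folklore] -/
theorem card_fibre_le (m n : ℕ) [NeZero m] [NeZero n] [NeZero (m * n)] (hmn : m.Coprime n)
    (δ : ZMod m) :
    #((polyRootsMod f (m * n)).filter (fun ν => ZMod.castHom (dvd_mul_right m n) (ZMod m) ν = δ)) ≤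
      polyRootCountMod ![f] n := by
  rw [← card_polyRootsMod]
  refine Finset.card_le_card_of_injOn (fun ν => ZMod.castHom (dvd_mul_left n m) (ZMod n) ν) ?_ ?_
  · intro ν hν
    rw [Finset.mem_coe, Finset.mem_filter] at hν
    exact castHom_mem_polyRootsMod f (dvd_mul_left n m) hν.1
  · intro ν hν ν' hν' heq
    rw [Finset.mem_coe, Finset.mem_filter] at hν hν'
    apply (ZMod.chineseRemainder hmn).injective
    refine Prod.ext ?_ ?_
    · rw [fst_chineseRemainder, fst_chineseRemainder, hν.2, hν'.2]
    · rw [snd_chineseRemainder, snd_chineseRemainder]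
      exact heq

/-- **The diagonal ("trivial bound `B_{nn}(M) ≪ M`", p. 433)**: for `(m, n) = 1`,
`|∑_{ν₁ ∈ R(mn)} ∑_{ν₂ ∈ R(mn), ν₂ ≡ ν₁ (m)} ψ(a ν₁) ψ(b ν₂)| ≤ ρ_f(mn) ρ_f(n)`.
[cite: DukeFriedlanderIwaniec1995, §5 p. 433] -/
theorem norm_diag_fibre_sum_le (m n : ℕ) [NeZero m] [NeZero n] [NeZero (m * n)] (hmn : m.Coprime n)
    (a b : ZMod (m * n)) :
    ‖∑ ν₁ ∈ polyRootsMod f (m * n), ∑ ν₂ ∈ (polyRootsMod f (m * n)).filter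
        (fun ν₂ => ZMod.castHom (dvd_mul_right m n) (ZMod m) ν₂ =
          ZMod.castHom (dvd_mul_right m n) (ZMod m) ν₁),
        ZMod.stdAddChar (a * ν₁) * ZMod.stdAddChar (b * ν₂)‖ ≤
      (polyRootCountMod ![f] (m * n) : ℝ) * polyRootCountMod ![f] n := by
  rw [← card_polyRootsMod f (m * n)]
  refine (norm_sum_le _ _).trans ?_
  have hinner : ∀ ν₁ ∈ polyRootsMod f (m * n),
      ‖∑ ν₂ ∈ (polyRootsMod f (m * n)).filter
        (fun ν₂ => ZMod.castHom (dvd_mul_right m n) (ZMod m) ν₂ =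
          ZMod.castHom (dvd_mul_right m n) (ZMod m) ν₁),
        ZMod.stdAddChar (a * ν₁) * ZMod.stdAddChar (b * ν₂)‖ ≤ (polyRootCountMod ![f] n : ℝ) := by
    intro ν₁ _
    refine (norm_sum_le _ _).trans ?_
    have h1 : ∀ ν₂ ∈ (polyRootsMod f (m * n)).filter
        (fun ν₂ => ZMod.castHom (dvd_mul_right m n) (ZMod m) ν₂ =
          ZMod.castHom (dvd_mul_right m n) (ZMod m) ν₁),
        ‖ZMod.stdAddChar (a * ν₁) * ZMod.stdAddChar (b * ν₂)‖ ≤ 1 := by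
      intro ν₂ _
      rw [norm_mul, norm_stdAddChar, norm_stdAddChar, mul_one]
    refine (Finset.sum_le_sum h1).trans ?_
    rw [Finset.sum_const, nsmul_eq_mul, mul_one]
    exact_mod_cast card_fibre_le f m n hmn _
  refine (Finset.sum_le_sum hinner).trans ?_
  rw [Finset.sum_const, nsmul_eq_mul]

/-! ### Off the diagonal: pairwise coprime `m, n₁, n₂` -/

/-- **The off-diagonal identity** ("In this case `m, n₁, n₂` are pairwise co-prime so we can
write `B_{n₁n₂}(M) = ∑ … ∑_{f(ν) ≡ 0 (mn₁n₂)} e(ν(n₂ − n₁)h / mn₁n₂)`", p. 433): for `m ⊥ n₂`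
and `n₁ ⊥ n₂`,
`∑_{ν₁ ∈ R(mn₁)} ∑_{ν₂ ∈ R(mn₂), ν₂ ≡ ν₁ (m)} ψ_{mn₁}(h ν₁) ψ_{mn₂}(−h ν₂) = W_f(h(n₂ − n₁); mn₁n₂)`.
The bijection is `ν ↦ (ν mod mn₁, ν mod mn₂)` (Chinese remainder theorem for `mn₁ ⊥ n₂` and
`m ⊥ n₂`), and `ψ_{mn₁n₂}(h(n₂ − n₁)ν) = ψ_{mn₁}(hν) ψ_{mn₂}(−hν)`.
[cite: DukeFriedlanderIwaniec1995, §5 p. 433] -/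
theorem crt_fibre_sum_eq (m n₁ n₂ : ℕ) [NeZero m] [NeZero n₁] [NeZero n₂] [NeZero (m * n₁)]
    [NeZero (m * n₂)] [NeZero (m * n₁ * n₂)] (hm2 : m.Coprime n₂) (h12 : n₁.Coprime n₂) (h : ℤ) :
    ∑ ν₁ ∈ polyRootsMod f (m * n₁), ∑ ν₂ ∈ (polyRootsMod f (m * n₂)).filter
        (fun ν₂ => ZMod.castHom (dvd_mul_right m n₂) (ZMod m) ν₂ =
          ZMod.castHom (dvd_mul_right m n₁) (ZMod m) ν₁),
        ZMod.stdAddChar ((h : ZMod (m * n₁)) * ν₁) * ZMod.stdAddChar ((-h : ZMod (m * n₂)) * ν₂) =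
      polyRootWeylSumZMod f (m * n₁ * n₂) ((h * ((n₂ : ℤ) - n₁) : ℤ) : ZMod (m * n₁ * n₂)) := by
  -- iterated reductions compose (Mathlib's `ZMod.castHom_comp`, pointwise)
  have castHom_castHom : ∀ {a b c : ℕ} (hab : a ∣ b) (hbc : b ∣ c) (x : ZMod c),
      ZMod.castHom hab (ZMod a) (ZMod.castHom hbc (ZMod b) x) = ZMod.castHom (hab.trans hbc) (ZMod a) x :=
    fun hab hbc x => RingHom.congr_fun (ZMod.castHom_comp hab hbc) x
  -- notation
  have hc : (m * n₁).Coprime n₂ := Nat.Coprime.mul_left hm2 h12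
  set N : ℕ := m * n₁ * n₂ with hN
  have hD₁ : m * n₁ ∣ N := dvd_mul_right _ _
  have hD₂ : m * n₂ ∣ N := ⟨n₁, by rw [hN]; ring⟩
  have hmN : m ∣ N := (dvd_mul_right m n₁).trans hD₁
  have hn₂N : n₂ ∣ N := dvd_mul_left _ _
  set π₁ : ZMod N →+* ZMod (m * n₁) := ZMod.castHom hD₁ (ZMod (m * n₁)) with hπ₁
  set π₂ : ZMod N →+* ZMod (m * n₂) := ZMod.castHom hD₂ (ZMod (m * n₂)) with hπ₂
  set e : ZMod (m * n₁ * n₂) ≃+* ZMod (m * n₁) × ZMod n₂ := ZMod.chineseRemainder hc with he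
  set e₂ : ZMod (m * n₂) ≃+* ZMod m × ZMod n₂ := ZMod.chineseRemainder hm2 with he₂
  -- rewrite the left side as a sum over the finset of congruent pairs
  rw [polyRootWeylSumZMod_def]
  have hL : ∑ ν₁ ∈ polyRootsMod f (m * n₁), ∑ ν₂ ∈ (polyRootsMod f (m * n₂)).filter
        (fun ν₂ => ZMod.castHom (dvd_mul_right m n₂) (ZMod m) ν₂ =
          ZMod.castHom (dvd_mul_right m n₁) (ZMod m) ν₁),
        ZMod.stdAddChar ((h : ZMod (m * n₁)) * ν₁) * ZMod.stdAddChar ((-h : ZMod (m * n₂)) * ν₂) =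
      ∑ p ∈ (polyRootsMod f (m * n₁) ×ˢ polyRootsMod f (m * n₂)).filter
        (fun p => ZMod.castHom (dvd_mul_right m n₂) (ZMod m) p.2 =
          ZMod.castHom (dvd_mul_right m n₁) (ZMod m) p.1),
        ZMod.stdAddChar ((h : ZMod (m * n₁)) * p.1) * ZMod.stdAddChar ((-h : ZMod (m * n₂)) * p.2) := by
    rw [Finset.sum_filter, Finset.sum_product]
    refine Finset.sum_congr rfl fun ν₁ _ => ?_
    rw [Finset.sum_filter]
  rw [hL]
  symm
  -- the bijection `ν ↦ (π₁ ν, π₂ ν)` with inverse `(x, y) ↦ e⁻¹ (x, y mod n₂)`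
  refine Finset.sum_nbij' (fun ν => (π₁ ν, π₂ ν))
    (fun p => e.symm (p.1, ZMod.castHom (dvd_mul_left n₂ m) (ZMod n₂) p.2)) ?_ ?_ ?_ ?_ ?_
  · -- maps roots to congruent pairs of roots
    intro ν hν
    rw [Finset.mem_filter, Finset.mem_product]
    refine ⟨⟨castHom_mem_polyRootsMod f hD₁ hν, castHom_mem_polyRootsMod f hD₂ hν⟩, ?_⟩
    simp only [hπ₁, hπ₂]
    rw [castHom_castHom, castHom_castHom]
  · -- the inverse lands in the roots modulo `N`
    intro p hp
    rw [Finset.mem_filter, Finset.mem_product] at hp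
    obtain ⟨⟨hp1, hp2⟩, _⟩ := hp
    rw [mem_polyRootsMod_mul_iff f hc]
    constructor
    · have := fst_chineseRemainder hc (e.symm (p.1, ZMod.castHom (dvd_mul_left n₂ m) (ZMod n₂) p.2))
      rw [he, RingEquiv.apply_symm_apply] at this
      rw [← this]
      exact hp1
    · have := snd_chineseRemainder hc (e.symm (p.1, ZMod.castHom (dvd_mul_left n₂ m) (ZMod n₂) p.2))
      rw [he, RingEquiv.apply_symm_apply] at this
      rw [← this]
      exact castHom_mem_polyRootsMod f (dvd_mul_left n₂ m) hp2
  · -- left inverse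
    intro ν _
    apply e.injective
    rw [RingEquiv.apply_symm_apply]
    refine Prod.ext ?_ ?_
    · rw [he, fst_chineseRemainder]
    · rw [he, snd_chineseRemainder]
      simp only [hπ₂]
      rw [castHom_castHom]
  · -- right inverse
    intro p hp
    rw [Finset.mem_filter, Finset.mem_product] at hp
    obtain ⟨-, hcong⟩ := hp
    have h1 : π₁ (e.symm (p.1, ZMod.castHom (dvd_mul_left n₂ m) (ZMod n₂) p.2)) = p.1 := by
      have := fst_chineseRemainder hc (e.symm (p.1, ZMod.castHom (dvd_mul_left n₂ m) (ZMod n₂) p.2))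
      rw [← he, RingEquiv.apply_symm_apply] at this
      exact this.symm
    have h2' : ZMod.castHom hn₂N (ZMod n₂) (e.symm (p.1, ZMod.castHom (dvd_mul_left n₂ m) (ZMod n₂) p.2)) =
        ZMod.castHom (dvd_mul_left n₂ m) (ZMod n₂) p.2 := by
      have := snd_chineseRemainder hc (e.symm (p.1, ZMod.castHom (dvd_mul_left n₂ m) (ZMod n₂) p.2))
      rw [← he, RingEquiv.apply_symm_apply] at this
      exact this.symm
    refine Prod.ext h1 ?_
    -- `π₂ ν` and `p.2` agree modulo `m` and modulo `n₂`
    apply e₂.injective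
    refine Prod.ext ?_ ?_
    · rw [he₂, fst_chineseRemainder, fst_chineseRemainder, hcong]
      conv_rhs => rw [← h1]
      simp only [hπ₁, hπ₂]
      rw [castHom_castHom, castHom_castHom]
    · rw [he₂, snd_chineseRemainder, snd_chineseRemainder]
      conv_rhs => rw [← h2']
      simp only [hπ₂]
      rw [castHom_castHom]
  · -- the summands: `ψ_N(h(n₂ − n₁)ν) = ψ_{mn₁}(h π₁ν) ψ_{mn₂}(−h π₂ν)`
    intro ν _
    have hsplit : (((h * ((n₂ : ℤ) - n₁) : ℤ) : ZMod N)) * ν =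
        (((h * (N / (m * n₁) : ℕ) : ℤ) : ZMod N)) * ν + (((-h * (N / (m * n₂) : ℕ) : ℤ) : ZMod N)) * ν := by
      have hq1 : N / (m * n₁) = n₂ := by
        rw [hN, Nat.mul_div_cancel_left _ (Nat.pos_of_ne_zero (NeZero.ne (m * n₁)))]
      have hq2 : N / (m * n₂) = n₁ := by
        rw [hN, show m * n₁ * n₂ = (m * n₂) * n₁ by ring,
          Nat.mul_div_cancel_left _ (Nat.pos_of_ne_zero (NeZero.ne (m * n₂)))]
      rw [hq1, hq2, ← add_mul]
      congr 1
      push_cast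
      ring
    rw [hsplit, AddChar.map_add_eq_mul, stdAddChar_mul_div hD₁ h ν, stdAddChar_mul_div hD₂ (-h) ν]
    simp only [hπ₁, hπ₂, Int.cast_neg]

end DFI1995

end Literature.NumberTheory.Sieve
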